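import Summits.CriticalPhenomena.PercolationContinuityZ3.Theorems.SahiCMTP2Maps

/-!
# Density-free cMTP₂ (Fuchs–Wang 2026, (5.1)) is invariant under coordinatewise increasing maps of the conditioned block

Support file of the Sahi cell (`prim-sahi`, typer seat, generation 18; `--supports stmt-CriticalPhenomena-4575`).
Theorems only (no definitions, no named facts, no sorries).

`SahiCMTP2Maps.isCMTP2Set_map_prodMap` covers maps of the second block with an upper adjoint (order isomorphisms).  Here
the general B4-type invariance for the conditioned block `ℝ^B`: for ANY measurable coordinatewise increasing map
`Ψ(y) = (ψᵢ(yᵢ))ᵢ` (not necessarily injective, surjective or continuous),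
`cMTP₂^set(X_B|X_A) ⟹ cMTP₂^set(Ψ(X_B)|X_A)` (**`isCMTP2Set_map_coordwise_monotone`**; cf. [FuchsWang2026] Rem. 2.13
(probability integral transform / copula invariance) and [ColangeloMullerScarsini2006] B4).  The point: `{Ψ(X_B) ≤ y'}` is
a product of one-dimensional LOWER SETS, and every such product is empty or an increasing union of lower orthants
(`exists_iUnion_Iic_of_isLowerSet`, `pi_lowerSet_eq_iUnion_Iic`), along which (5.1) passes to the limit
(`iUnion_Iic_mul_le_of_isCMTP2Set`).

No sorries, no new axioms.
-/

noncomputable section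

namespace Summit.CriticalPhenomena.PercolationContinuityZ3.Theorems.SahiCMTP2

open MeasureTheory Set Filter Topology Function
open Literature.Probability.LatticeModels Literature.Probability.LatticeModels.Affiliation
open Summit.CriticalPhenomena.PercolationContinuityZ3.Theorems.SahiBoxTP2 (measure_mul_le_of_monotone_iUnion)
open scoped ENNReal SetFamily

/-! ### Lower sets of `ℝ` and their products -/

/-- **A nonempty lower set of `ℝ` is an increasing union of closed rays** (`ℝ`, `(−∞,s]` or `(−∞,s)`). [folklore] -/
theorem exists_iUnion_Iic_of_isLowerSet {L : Set ℝ} (hL : IsLowerSet L) (hne : L.Nonempty) :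
    ∃ u : ℕ → ℝ, Monotone u ∧ L = ⋃ n, Iic (u n) := by
  by_cases hb : BddAbove L
  · set s := sSup L with hs_def
    have hIio : Iio s ⊆ L := fun t ht => by
      obtain ⟨l, hl, htl⟩ := exists_lt_of_lt_csSup hne ht
      exact hL htl.le hl
    have hIic : L ⊆ Iic s := fun t ht => le_csSup hb ht
    by_cases hs : s ∈ L
    · refine ⟨fun _ => s, fun _ _ _ => le_rfl, ?_⟩
      rw [iUnion_const]
      exact hIic.antisymm fun t ht => hL ht hs
    · refine ⟨fun n => s - 1 / ((n : ℝ) + 1), fun m n hmn => ?_, ?_⟩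
      · dsimp only
        gcongr
      · ext t
        simp only [mem_iUnion, mem_Iic]
        constructor
        · intro ht
          have hlt : t < s := lt_of_le_of_ne (hIic ht) fun h => hs (h ▸ ht)
          obtain ⟨n, hn⟩ := exists_nat_one_div_lt (sub_pos.2 hlt)
          exact ⟨n, by linarith⟩
        · rintro ⟨n, hn⟩
          have hpos : (0 : ℝ) < 1 / ((n : ℝ) + 1) := by positivity
          exact hIio (show t < s by linarith)
  · refine ⟨fun n => (n : ℝ), Nat.mono_cast, ?_⟩
    ext t
    simp only [mem_iUnion, mem_Iic]
    constructor
    · intro _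
      exact exists_nat_ge t
    · rintro ⟨n, _⟩
      by_contra ht
      exact hb ⟨t, fun l hl => le_of_not_gt fun hlt => ht (hL hlt.le hl)⟩

/-- **A product of nonempty lower sets of `ℝ` is an increasing union of lower orthants of `ℝ^B`** (`B` finite).
[folklore] -/
theorem pi_lowerSet_eq_iUnion_Iic {κ : Type*} [Fintype κ] {L : κ → Set ℝ} (hL : ∀ i, IsLowerSet (L i))
    (hne : ∀ i, (L i).Nonempty) : ∃ t : ℕ → κ → ℝ, Monotone t ∧ Set.pi univ L = ⋃ n, Iic (t n) := by
  choose u hu hLu using fun i => exists_iUnion_Iic_of_isLowerSet (hL i) (hne i)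
  refine ⟨fun n i => u i n, fun m n hmn i => hu i hmn, ?_⟩
  ext w
  simp only [mem_univ_pi, mem_iUnion, mem_Iic]
  constructor
  · intro hw
    have hex : ∀ i, ∃ n, w i ≤ u i n := fun i => by
      have hi := hw i
      rw [hLu i, mem_iUnion] at hi
      exact hi
    choose n hn using hex
    exact ⟨Finset.univ.sup n, fun i => (hn i).trans (hu i (Finset.le_sup (Finset.mem_univ i)))⟩
  · rintro ⟨n, hn⟩ i
    rw [hLu i, mem_iUnion]
    exact ⟨n, hn i⟩

/-! ### (5.1) along increasing unions of orthants -/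

section Unions

variable {X Y : Type*} [MeasurableSpace X] [MeasurableSpace Y] [Lattice X] [Lattice Y]

/-- **(5.1) passes to increasing unions of lower orthants in the second block**: for monotone sequences `t, t'`,
`μ(C × ⋃(−∞,tₙ]) μ(D × ⋃(−∞,t'ₙ]) ≤ μ((C∧D) × ⋃(−∞,tₙ∧t'ₙ]) μ((C∨D) × ⋃(−∞,tₙ∨t'ₙ])`. [this work] -/
theorem iUnion_Iic_mul_le_of_isCMTP2Set {μ : Measure (X × Y)} (h : IsCMTP2Set μ) {C D : Set X}
    (hC : MeasurableSet C) (hD : MeasurableSet D) {t t' : ℕ → Y} (ht : Monotone t) (ht' : Monotone t') :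
    μ (C ×ˢ ⋃ n, Iic (t n)) * μ (D ×ˢ ⋃ n, Iic (t' n)) ≤
      μ ((C ⊼ D) ×ˢ ⋃ n, Iic (t n ⊓ t' n)) * μ ((C ⊻ D) ×ˢ ⋃ n, Iic (t n ⊔ t' n)) := by
  have hmono : ∀ (S : Set X) {s : ℕ → Y}, Monotone s → Monotone fun n => S ×ˢ Iic (s n) :=
    fun S s hs m n hmn => Set.prod_mono Subset.rfl (Iic_subset_Iic.2 (hs hmn))
  simp only [Set.prod_iUnion]
  exact measure_mul_le_of_monotone_iUnion μ (hmono C ht) (hmono D ht')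
    (hmono (C ⊼ D) fun m n hmn => inf_le_inf (ht hmn) (ht' hmn))
    (hmono (C ⊻ D) fun m n hmn => sup_le_sup (ht hmn) (ht' hmn)) fun n => h hC hD (t n) (t' n)

end Unions

/-! ### Coordinatewise increasing maps of the conditioned block -/

section Monotone

variable {X κ : Type*} [MeasurableSpace X] [Lattice X] [Fintype κ]

omit [MeasurableSpace X] [Lattice X] [Fintype κ] in
/-- Preimage of a conditional-orthant event under `id × Ψ`, `Ψ` coordinatewise: a product of one-dimensional preimages.
[folklore] -/
theorem preimage_prodMap_coordwise (ψ : κ → ℝ → ℝ) (S : Set X) (y' : κ → ℝ) :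
    Prod.map (id : X → X) (fun y : κ → ℝ => fun i => ψ i (y i)) ⁻¹' (S ×ˢ Iic y') =
      S ×ˢ Set.pi univ (fun i => ψ i ⁻¹' Iic (y' i)) := by
  ext p
  simp only [mem_preimage, mem_prod, Prod.map_fst, Prod.map_snd, id_eq, mem_Iic, mem_univ_pi, Pi.le_def]

/-- **(5.1) is invariant under measurable coordinatewise increasing maps of the conditioned block** (B4-type invariance;
no injectivity or continuity needed): `cMTP₂^set(X_B|X_A) ⟹ cMTP₂^set(Ψ(X_B)|X_A)` for `Ψ(y) = (ψᵢ(yᵢ))ᵢ`. [this work] -/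
theorem isCMTP2Set_map_coordwise_monotone {μ : Measure (X × (κ → ℝ))} (h : IsCMTP2Set μ) {ψ : κ → ℝ → ℝ}
    (hψm : ∀ i, Measurable (ψ i)) (hψ : ∀ i, Monotone (ψ i)) :
    IsCMTP2Set (μ.map (Prod.map id fun y : κ → ℝ => fun i => ψ i (y i))) := by
  intro C D hC hD y₁ y₂
  have hΨ : Measurable fun y : κ → ℝ => fun i => ψ i (y i) :=
    measurable_pi_iff.2 fun i => (hψm i).comp (measurable_pi_apply i)
  have hm : Measurable (Prod.map (id : X → X) fun y : κ → ℝ => fun i => ψ i (y i)) := measurable_id.prodMap hΨ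
  rw [Measure.map_apply hm (hC.prod measurableSet_Iic), Measure.map_apply hm (hD.prod measurableSet_Iic),
    preimage_prodMap_coordwise, preimage_prodMap_coordwise]
  set L₁ : κ → Set ℝ := fun i => ψ i ⁻¹' Iic (y₁ i) with hL₁
  set L₂ : κ → Set ℝ := fun i => ψ i ⁻¹' Iic (y₂ i) with hL₂
  -- degenerate cases: an empty factor
  by_cases hne₁ : ∀ i, (L₁ i).Nonempty
  swap
  · push Not at hne₁
    obtain ⟨i, hi⟩ := hne₁
    rw [Set.univ_pi_eq_empty hi, Set.prod_empty, measure_empty, zero_mul]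
    exact bot_le
  by_cases hne₂ : ∀ i, (L₂ i).Nonempty
  swap
  · push Not at hne₂
    obtain ⟨i, hi⟩ := hne₂
    rw [Set.univ_pi_eq_empty hi, Set.prod_empty, measure_empty, mul_zero]
    exact bot_le
  obtain ⟨t, ht, ht₁⟩ := pi_lowerSet_eq_iUnion_Iic (fun i => IsLowerSet.preimage (isLowerSet_Iic _) (hψ i)) hne₁
  obtain ⟨t', ht', ht₂⟩ := pi_lowerSet_eq_iUnion_Iic (fun i => IsLowerSet.preimage (isLowerSet_Iic _) (hψ i)) hne₂
  -- `tₙ` itself lies in the product, i.e. `ψᵢ(tₙ i) ≤ y₁ i`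
  have htmem : ∀ n i, ψ i (t n i) ≤ y₁ i := fun n i => by
    have hmem : t n ∈ ⋃ m, Iic (t m) := mem_iUnion.2 ⟨n, self_mem_Iic⟩
    rw [← ht₁, mem_univ_pi] at hmem
    exact hmem i
  have ht'mem : ∀ n i, ψ i (t' n i) ≤ y₂ i := fun n i => by
    have hmem : t' n ∈ ⋃ m, Iic (t' m) := mem_iUnion.2 ⟨n, self_mem_Iic⟩
    rw [← ht₂, mem_univ_pi] at hmem
    exact hmem i
  rw [ht₁, ht₂]
  refine (iUnion_Iic_mul_le_of_isCMTP2Set h hC hD ht ht').trans (mul_le_mul' ?_ ?_)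
  · calc μ ((C ⊼ D) ×ˢ ⋃ n, Iic (t n ⊓ t' n))
        ≤ μ (Prod.map (id : X → X) (fun y : κ → ℝ => fun i => ψ i (y i)) ⁻¹' ((C ⊼ D) ×ˢ Iic (y₁ ⊓ y₂))) := by
          rw [preimage_prodMap_coordwise]
          refine measure_mono (Set.prod_mono Subset.rfl (iUnion_subset fun n w hw i _ => ?_))
          show ψ i (w i) ≤ (y₁ ⊓ y₂) i
          exact le_inf (((hψ i) ((hw i).trans inf_le_left)).trans (htmem n i))
            (((hψ i) ((hw i).trans inf_le_right)).trans (ht'mem n i))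
      _ ≤ μ.map (Prod.map id fun y : κ → ℝ => fun i => ψ i (y i)) ((C ⊼ D) ×ˢ Iic (y₁ ⊓ y₂)) :=
          Measure.le_map_apply hm.aemeasurable _
  · calc μ ((C ⊻ D) ×ˢ ⋃ n, Iic (t n ⊔ t' n))
        ≤ μ (Prod.map (id : X → X) (fun y : κ → ℝ => fun i => ψ i (y i)) ⁻¹' ((C ⊻ D) ×ˢ Iic (y₁ ⊔ y₂))) := by
          rw [preimage_prodMap_coordwise]
          refine measure_mono (Set.prod_mono Subset.rfl (iUnion_subset fun n w hw i _ => ?_))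
          show ψ i (w i) ≤ (y₁ ⊔ y₂) i
          calc ψ i (w i) ≤ ψ i (t n i ⊔ t' n i) := hψ i (hw i)
            _ = ψ i (t n i) ⊔ ψ i (t' n i) := (hψ i).map_sup _ _
            _ ≤ y₁ i ⊔ y₂ i := sup_le_sup (htmem n i) (ht'mem n i)
      _ ≤ μ.map (Prod.map id fun y : κ → ℝ => fun i => ψ i (y i)) ((C ⊻ D) ×ˢ Iic (y₁ ⊔ y₂)) :=
          Measure.le_map_apply hm.aemeasurable _

end Monotone

end Summit.CriticalPhenomena.PercolationContinuityZ3.Theorems.SahiCMTP2
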